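import Summits.SmoothPoincare4.SmoothPoincare4.Theorems.ConvexBisectionAcyclicBisectionExistsPageInvariance
import Summits.SmoothPoincare4.SmoothPoincare4.Theorems.ConvexBisectionAcyclicBisectionExistsPicardLefschetzNode
import Summits.SmoothPoincare4.SmoothPoincare4.Theorems.ConvexBisectionAcyclicBisectionExistsBeltPageClause
import HarnessLib

/-!
# N1-move, piece (e): the class bookkeeping of a handle dragged through pages
(wave 7, brick of stub `stub_M2geo` = node N1 of NF4 ▸ `node_N1_move` ▸ piece (e) of the contract
`node_N1_move ⇐ (a) ∧ (c) ∧ (d) ∧ (e)` (`N1_Move_Design.lean`, H7), line `modp-braid-orbits`, crux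
`ConvexBisection.AcyclicBisectionExists`, item stmt-SmoothPoincare4-10508; registered sub-goal
`helper_shadow_seamTransport_free`)

In the N1 contract the new attaching circle of the dragged handle is described through the gluing
map `Ψ : ∂X₀ ≅ ∂ Base g` of the fibred datum: a page loop `L` (the push-off of the old attaching
circle, a SEAM loop: `G₀ (bX.incl (y θ)) = D.jA (a θ)`, `a θ = L θ`) is carried to the loop `L'`
read back on the base from the boundary points `y' θ` with `Ψ (y' θ) = R_T (Ψ (y θ))`, `R` the
rigid page rotation (`w ∘ R_t = e^{it} w`).  This file proves the bookkeeping the contract needs: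

* §1 `continuousOn_invFun_range` — the inverse of a topological embedding is continuous on its range;
* §2 **`shadow_seamTransport_free`** — if the closed arc of directions from `c₀` (the page of `L`)
  to `c₀ e^{iT}` contains NO belt direction `d k`, then `shadow L' = shadow L`: the transported
  points `Ψ⁻¹ (R_{tT} (Ψ (y θ)))`, `t ∈ [0, 1]`, are never deep belt points (the belt clause would put
  `d k` on the arc), so they are seam points and reading them on the base (`jA⁻¹`, continuous on
  `range jA`) is a homotopy of loops from `L` to `L'` (`shadow_eq_of_family`);
* §3 `shadow_eq_transvection_of_homotopic_twist` — the N1a bridge for piece (d): a loop homotopic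
  to the image of a page loop under an N1a-presented page Dehn twist has the transvected shadow
  (`shadow_pageDehnTwist_eq_transvection`, p157857, + `shadow_eq_of_homotopic`);
* §4 the registered form `helper_shadow_seamTransport_free`.

Everything is proved; no definitions, no named facts, no `sorry`.  References: R. E. Gompf,
A. I. Stipsicz, *4-Manifolds and Kirby Calculus* (1999), §8.2 [GompfStipsicz1999]; A. Hatcher,
*Algebraic Topology* (2002), Thm. 2A.1 [HatcherAT2002].
-/

noncomputable section

set_option linter.dupNamespace false

open scoped Manifold ContDiff Topology Real
open Set Function

namespace Summit.SmoothPoincare4.SmoothPoincare4.Theorems.AcyclicBisectionExists.ModpBraidOrbits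

open Literature.GroupTheory.CombinatorialGroupTheory.SignedHurwitz
open Literature.Topology.FourManifolds Literature.Topology.FourManifolds.LefschetzBase
open Literature.Topology.FourManifolds.HandleAttachingMap

namespace HurwitzMoveClasses

/-! ## §1 Inverses of embeddings -/

/-- **The inverse of a topological embedding is continuous on its range** (it is the inverse
homeomorphism `range f ≅ X` there). [folklore] -/
theorem continuousOn_invFun_range {X Y : Type*} [TopologicalSpace X] [TopologicalSpace Y]
    [Nonempty X] {f : X → Y} (hf : Topology.IsEmbedding f) :
    ContinuousOn (Function.invFun f) (range f) := by
  rw [continuousOn_iff_continuous_restrict]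
  have e : (range f).restrict (Function.invFun f) = fun y => hf.toHomeomorph.symm y := by
    funext y
    obtain ⟨x, hx⟩ := y.2
    have hy : y = ⟨f x, mem_range_self x⟩ := Subtype.ext hx.symm
    rw [hy]
    show Function.invFun f (f x) = hf.toHomeomorph.symm ⟨f x, _⟩
    rw [Function.leftInverse_invFun hf.injective x, hf.toHomeomorph_symm_apply]
  rw [e]
  exact hf.toHomeomorph.symm.continuous.comp continuous_id

/-- The inverse of an injective map on a value: `invFun f (f x) = x`. [folklore] -/
theorem invFun_apply {X Y : Type*} [Nonempty X] {f : X → Y} (hf : Injective f) (x : X) :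
    Function.invFun f (f x) = x :=
  Function.leftInverse_invFun hf x

/-! ## §2 Free seam transport preserves the shadow -/

section Free

variable {g n : ℕ} {X₀ : Type} [TopologicalSpace X₀] [ChartedSpace (EuclideanHalfSpace 4) X₀]
  (bX : BoundaryData (𝓡∂ 4) X₀ (𝓡 3)) (Ψ : bX.carrier ≃ₘ⟮𝓡 3, 𝓡 3⟯ (bBase g).carrier)
  {X : Type} [TopologicalSpace X] [ChartedSpace (EuclideanHalfSpace 4) X]
  (G₀ : X₀ ≃ₘ⟮𝓡∂ 4, 𝓡∂ 4⟯ X)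
  {h : Fin n → HandleAttachingMap 3 2 (Base g)} (D : MultiAttachmentData h (𝓡∂ 4) X)
  {d : Fin n → ℂ}

/-- **A seam point rotated within a belt-free arc stays a seam point.**  If `G₀ (bX.incl y) =
D.jA a` with `a` in the page of direction `c₀`, `z` is the boundary point with
`Ψ z = R_τ (Ψ y)` (`R` the rigid rotation), and no belt direction `d k` equals `c₀ e^{iτ}`, then
`G₀ (bX.incl z)` lies in `range D.jA`. [cite: GompfStipsicz1999, §8.2] -/
theorem mem_range_jA_of_rotate (hd : ∀ k, ‖d k‖ = 1)
    (hseam : ∀ (y : bX.carrier) (a : ↥(coresComplement h)), G₀ (bX.incl y) = D.jA a →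
      ∃ c : ℝ, 0 < c ∧ w g ((bBase g).incl (Ψ y)).1 = (c : ℂ) * w g (a : Base g).1)
    (hbelt : ∀ (y : bX.carrier) (k : Fin n) (b : ↥(beltPiece 3 2)), G₀ (bX.incl y) = D.jB k b →
      G₀ (bX.incl y) ∉ range D.jA →
      ∃ c : ℝ, 0 < c ∧ w g ((bBase g).incl (Ψ y)).1 = (c : ℂ) * d k)
    (R : AmbientIsotopy (𝓡∂ 4) (Base g))
    (hRw : ∀ (t : ℝ) (x : Base g), w g (R.toFun t x).1 = Complex.exp ((t : ℂ) * Complex.I) * w g x.1)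
    {c₀ : ℂ} (hc₀ : ‖c₀‖ = 1) {τ : ℝ}
    (hfree : ∀ k, d k ≠ c₀ * Complex.exp ((τ : ℂ) * Complex.I))
    {y z : bX.carrier} {a : ↥(coresComplement h)} (hy : G₀ (bX.incl y) = D.jA a)
    (ha : (a : Base g) ∈ page g c₀)
    (hz : (bBase g).incl (Ψ z) = R.toFun τ ((bBase g).incl (Ψ y))) :
    G₀ (bX.incl z) ∈ range D.jA := by
  by_contra hnot
  have hcov : G₀ (bX.incl z) ∈ range D.jA ∪ ⋃ k, range (D.jB k) := by
    rw [D.cover]; exact mem_univ _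
  rcases hcov with hA | hB
  · exact hnot hA
  obtain ⟨k, b, hb⟩ : ∃ (k : Fin n) (b : ↥(beltPiece 3 2)), D.jB k b = G₀ (bX.incl z) := by
    simpa only [mem_iUnion, mem_range] using hB
  obtain ⟨c, hc, hcw⟩ := hbelt z k b hb.symm hnot
  obtain ⟨c', hc', hcw'⟩ := hseam y a hy
  rw [hz, hRw, hcw', ha.2] at hcw
  have e : (c : ℂ) * d k = ((c' / 2 : ℝ) : ℂ) * (c₀ * Complex.exp ((τ : ℂ) * Complex.I)) := by
    rw [← hcw]; push_cast; ring
  have hu' : ‖c₀ * Complex.exp ((τ : ℂ) * Complex.I)‖ = 1 := by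
    rw [norm_mul, hc₀, Complex.norm_exp_ofReal_mul_I, mul_one]
  -- compare norms: the two positive factors agree, hence the unit directions agree
  have hn := congrArg (fun z : ℂ => ‖z‖) e
  have hc2 : 0 < c' / 2 := by positivity
  simp only [norm_mul, Complex.norm_real, Real.norm_eq_abs, abs_of_pos hc, abs_of_pos hc2, hd k,
    hu', mul_one] at hn
  rw [hn] at e
  have hc0 : ((c' / 2 : ℝ) : ℂ) ≠ 0 := by exact_mod_cast hc2.ne'
  exact hfree k (mul_left_cancel₀ hc0 e)

/-- **Free seam transport preserves the shadow** (piece (e) of the N1 contract).  Data: the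
fibred datum `(X₀, bX, Ψ, X, G₀, h, D)` with unit belt directions `d`, the seam clause and the belt
clause through `G₀`; the rigid page rotation `R` (`rho ∘ R_t = rho`, `w ∘ R_t = e^{it} w`); a unit
direction `c₀` and an angle `T` such that no `d k` lies on the closed arc `c₀ e^{itT}`,
`t ∈ [0, 1]`; a loop `L` in `page g c₀` presented by seam points (`G₀ (bX.incl (y θ)) = D.jA (a θ)`,
`a θ = L θ`) and the loop `L'` presented by the transported points
(`Ψ (y' θ) = R_T (Ψ (y θ))`, `G₀ (bX.incl (y' θ)) = D.jA (a' θ)`, `a' θ = L' θ`).  Then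
`shadow L' = shadow L`: the loops `t ↦ jA⁻¹ (G₀ (bX.incl (Ψ⁻¹ (R_{tT} (Ψ (y θ))))))` are a homotopy
(all transported points are seam points, `mem_range_jA_of_rotate`). [cite: GompfStipsicz1999, §8.2] -/
theorem shadow_seamTransport_free (hd : ∀ k, ‖d k‖ = 1)
    (hseam : ∀ (y : bX.carrier) (a : ↥(coresComplement h)), G₀ (bX.incl y) = D.jA a →
      ∃ c : ℝ, 0 < c ∧ w g ((bBase g).incl (Ψ y)).1 = (c : ℂ) * w g (a : Base g).1)
    (hbelt : ∀ (y : bX.carrier) (k : Fin n) (b : ↥(beltPiece 3 2)), G₀ (bX.incl y) = D.jB k b →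
      G₀ (bX.incl y) ∉ range D.jA →
      ∃ c : ℝ, 0 < c ∧ w g ((bBase g).incl (Ψ y)).1 = (c : ℂ) * d k)
    (R : AmbientIsotopy (𝓡∂ 4) (Base g))
    (hRρ : ∀ (t : ℝ) (x : Base g), rho g (R.toFun t x).1 = rho g x.1)
    (hRw : ∀ (t : ℝ) (x : Base g), w g (R.toFun t x).1 = Complex.exp ((t : ℂ) * Complex.I) * w g x.1)
    {c₀ : ℂ} (hc₀ : ‖c₀‖ = 1) (T : ℝ)
    (hfree : ∀ k, ∀ t ∈ Icc (0 : ℝ) 1, d k ≠ c₀ * Complex.exp (((t * T : ℝ) : ℂ) * Complex.I))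
    {L L' : Metric.sphere (0 : EuclideanSpace ℝ (Fin 2)) 1 → Base g} (hL : Continuous L)
    (hL' : Continuous L') {y y' : Metric.sphere (0 : EuclideanSpace ℝ (Fin 2)) 1 → bX.carrier}
    {a a' : Metric.sphere (0 : EuclideanSpace ℝ (Fin 2)) 1 → ↥(coresComplement h)}
    (hLp : ∀ θ, L θ ∈ page g c₀) (hy : ∀ θ, G₀ (bX.incl (y θ)) = D.jA (a θ))
    (ha : ∀ θ, ((a θ : ↥(coresComplement h)) : Base g) = L θ)
    (hrel : ∀ θ, (bBase g).incl (Ψ (y' θ)) = R.toFun T ((bBase g).incl (Ψ (y θ))))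
    (hy' : ∀ θ, G₀ (bX.incl (y' θ)) = D.jA (a' θ))
    (ha' : ∀ θ, ((a' θ : ↥(coresComplement h)) : Base g) = L' θ) :
    shadow g L' hL' = shadow g L hL := by
  classical
  -- a base point of the circle, for the `Nonempty` instances of the inverse functions
  have θ₀ : Metric.sphere (0 : EuclideanSpace ℝ (Fin 2)) 1 := circlePt 0
  haveI : Nonempty bX.carrier := ⟨y θ₀⟩
  haveI : Nonempty ↥(coresComplement h) := ⟨a θ₀⟩
  haveI : Nonempty (bBase g).carrier := ⟨Ψ (y θ₀)⟩
  -- the embeddings and their inverses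
  have hincl : Topology.IsEmbedding (bBase g).incl := (bBase g).isSmoothEmbedding.isEmbedding
  have hGi : Topology.IsEmbedding (fun x : bX.carrier => G₀ (bX.incl x)) :=
    G₀.toHomeomorph.isEmbedding.comp bX.isSmoothEmbedding.isEmbedding
  have hjA : Topology.IsEmbedding D.jA := D.hjA.isEmbedding
  set iB : Base g → (bBase g).carrier := Function.invFun (bBase g).incl with hiB
  set iA : X → ↥(coresComplement h) := Function.invFun D.jA with hiA
  set iG : X → bX.carrier := Function.invFun (fun x : bX.carrier => G₀ (bX.incl x)) with hiG
  have hiBc : ContinuousOn iB (range (bBase g).incl) := continuousOn_invFun_range hincl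
  have hiAc : ContinuousOn iA (range D.jA) := continuousOn_invFun_range hjA
  have hiGc : ContinuousOn iG (range fun x : bX.carrier => G₀ (bX.incl x)) :=
    continuousOn_invFun_range hGi
  -- `y` is continuous: it is `(G₀ ∘ incl)⁻¹ ∘ jA ∘ a`
  have hac : Continuous a := by
    have : Continuous fun θ => ((a θ : ↥(coresComplement h)) : Base g) := by
      simp_rw [ha]; exact hL
    exact continuous_induced_rng.2 this
  have hyc : Continuous y := by
    have e : y = fun θ => iG (D.jA (a θ)) := by
      funext θ; rw [← hy θ, hiG, invFun_apply hGi.injective]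
    rw [e]
    refine hiGc.comp_continuous (D.hjA.isEmbedding.continuous.comp hac) fun θ => ?_
    exact ⟨y θ, hy θ⟩
  -- the rotated boundary points `ζ t θ`, `incl (ζ t θ) = R_{tT} (incl (Ψ (y θ)))`
  set zB : ℝ → Metric.sphere (0 : EuclideanSpace ℝ (Fin 2)) 1 → Base g :=
    fun t θ => R.toFun (t * T) ((bBase g).incl (Ψ (y θ))) with hzB
  have hzBmem : ∀ t θ, zB t θ ∈ range (bBase g).incl := by
    intro t θ
    rw [(bBase g).range_incl, RegularSublevel.mem_boundary_iff]
    show rho g (R.toFun (t * T) ((bBase g).incl (Ψ (y θ)))).1 = 1 / 4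
    rw [hRρ]
    exact (RegularSublevel.mem_boundary_iff (isRegularLevel_rho g) _).1
      ((bBase g).incl_mem_boundary _)
  have hzBincl : ∀ t θ, (bBase g).incl (iB (zB t θ)) = zB t θ := fun t θ =>
    Function.invFun_eq (hzBmem t θ)
  have hzBc : Continuous (uncurry zB) := by
    have hRc : Continuous (uncurry R.toFun) := R.contMDiff.continuous
    exact hRc.comp (((continuous_fst.mul continuous_const)).prodMk
      ((bBase g).continuous_incl.comp (Ψ.continuous.comp (hyc.comp continuous_snd))))
  -- the transported points of `X`
  set q : ℝ → Metric.sphere (0 : EuclideanSpace ℝ (Fin 2)) 1 → X :=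
    fun t θ => G₀ (bX.incl (Ψ.symm (iB (zB t θ)))) with hq
  have hqc : Continuous (uncurry q) := by
    have h1 : Continuous fun p : ℝ × Metric.sphere (0 : EuclideanSpace ℝ (Fin 2)) 1 =>
        iB (zB p.1 p.2) :=
      hiBc.comp_continuous hzBc fun p => hzBmem p.1 p.2
    exact G₀.continuous.comp (bX.continuous_incl.comp (Ψ.symm.continuous.comp h1))
  have hqmem : ∀ t ∈ Icc (0 : ℝ) 1, ∀ θ, q t θ ∈ range D.jA := by
    intro t ht θ
    refine mem_range_jA_of_rotate bX Ψ G₀ D hd hseam hbelt R hRw hc₀ (τ := t * T)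
      (fun k => ?_) (hy θ) ((ha θ).symm ▸ hLp θ) ?_
    · have := hfree k t ht; push_cast at this ⊢; exact this
    · show (bBase g).incl (Ψ (Ψ.symm (iB (zB t θ)))) = R.toFun (t * T) ((bBase g).incl (Ψ (y θ)))
      rw [Diffeomorph.apply_symm_apply, hzBincl]
  -- the homotopy of base loops
  set H : ℝ → Metric.sphere (0 : EuclideanSpace ℝ (Fin 2)) 1 → Base g :=
    fun t θ => ((iA (q t θ) : ↥(coresComplement h)) : Base g) with hH
  have hHc : ContinuousOn (uncurry H) (Icc (0 : ℝ) 1 ×ˢ univ) := by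
    have h1 : ContinuousOn (fun p : ℝ × Metric.sphere (0 : EuclideanSpace ℝ (Fin 2)) 1 =>
        iA (q p.1 p.2)) (Icc (0 : ℝ) 1 ×ˢ univ) :=
      hiAc.comp hqc.continuousOn fun p hp => hqmem p.1 hp.1 p.2
    exact continuous_subtype_val.comp_continuousOn h1
  -- end points
  have hq0 : ∀ θ, q 0 θ = D.jA (a θ) := by
    intro θ
    have e : iB (zB 0 θ) = Ψ (y θ) := by
      apply (bBase g).injective_incl
      rw [hzBincl]
      show R.toFun (0 * T) ((bBase g).incl (Ψ (y θ))) = _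
      rw [zero_mul, R.map_zero]; rfl
    show G₀ (bX.incl (Ψ.symm (iB (zB 0 θ)))) = D.jA (a θ)
    rw [e, Diffeomorph.symm_apply_apply, hy]
  have hq1 : ∀ θ, q 1 θ = D.jA (a' θ) := by
    intro θ
    have e : iB (zB 1 θ) = Ψ (y' θ) := by
      apply (bBase g).injective_incl
      rw [hzBincl, hrel]
      show R.toFun (1 * T) ((bBase g).incl (Ψ (y θ))) = _
      rw [one_mul]
    show G₀ (bX.incl (Ψ.symm (iB (zB 1 θ)))) = D.jA (a' θ)
    rw [e, Diffeomorph.symm_apply_apply, hy']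
  have hH0 : ∀ θ, H 0 θ = L θ := fun θ => by
    show ((iA (q 0 θ) : ↥(coresComplement h)) : Base g) = L θ
    rw [hq0, hiA, invFun_apply hjA.injective, ha]
  have hH1 : ∀ θ, H 1 θ = L' θ := fun θ => by
    show ((iA (q 1 θ) : ↥(coresComplement h)) : Base g) = L' θ
    rw [hq1, hiA, invFun_apply hjA.injective, ha']
  exact (shadow_eq_of_family H hHc hL hL' hH0 hH1).symm

end Free

/-! ## §3 The N1a bridge for piece (d): a loop homotopic to a Dehn-twisted page loop -/

/-- **A loop homotopic to the image of a page loop under an N1a-presented page Dehn twist has the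
transvected shadow**: `shadow L' = transvection (stdSymp ℤ g) (shadow a, s) (shadow K)` whenever
`L'` is homotopic to `τ ∘ K` (`τ` the right- (`s = true`) resp. left-handed Dehn twist along `a`
presented in the annulus chart `φ` with profile `β`, as in `shadow_pageDehnTwist_eq_transvection`).
This is the form in which a point-set monodromy model (the across-belt transport is such a `τ` up to
homotopy) yields the shadow-level piece (d) of the N1 contract.
[cite: FarbMargalit2012, Prop. 6.3] -/
theorem shadow_eq_transvection_of_homotopic_twist (g : ℕ) {c : ℂ} (hc : ‖c‖ = 1)
    (τ : Base g → Base g) (hτ : Continuous τ)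
    {a : Metric.sphere (0 : EuclideanSpace ℝ (Fin 2)) 1 → Base g} (ha : Continuous a) (s : Bool)
    (φ : ℝ × ℝ → Base g) (β : ℝ → ℝ)
    (hφs : ContMDiff 𝓘(ℝ, ℝ × ℝ) (𝓡∂ 4) ∞ φ) (hφ1 : ∀ u r, φ (u + 1, r) = φ (u, r))
    (hφa : ∀ u, φ (u, 0) = a (circlePt u)) (hφp : ∀ p, φ p ∈ page g c)
    (hφi : InjOn φ (Ico (0 : ℝ) 1 ×ˢ Ioo (-1 : ℝ) 1))
    (hφo : ∀ u r, r ∈ Ioo (-1 : ℝ) 1 →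
      0 < inner ℝ (deriv (fun r' => (φ (u, r')).1) r) (cplxJ (deriv (fun u' => (φ (u', r)).1) u)))
    (hβs : ContDiff ℝ ∞ β) (hβ0 : ∀ r ≤ -(1 / 2 : ℝ), β r = 0) (hβ1 : ∀ r ≥ (1 / 2 : ℝ), β r = 1)
    (hτon : ∀ u r, r ∈ Ioo (-1 : ℝ) 1 → τ (φ (u, r)) = φ (u + (if s then β r else -β r), r))
    (hτoff : ∀ p ∈ page g c, p ∉ φ '' (univ ×ˢ Ioo (-1 : ℝ) 1) → τ p = p)
    {K L' : Metric.sphere (0 : EuclideanSpace ℝ (Fin 2)) 1 → Base g} (hK : Continuous K)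
    (hKc : ∀ θ, K θ ∈ page g c) (hL' : Continuous L')
    (hhom : (⟨L', hL'⟩ : C(Metric.sphere (0 : EuclideanSpace ℝ (Fin 2)) 1, Base g)).Homotopic
      ⟨τ ∘ K, hτ.comp hK⟩) :
    shadow g L' hL' = transvection (stdSymp ℤ g) (shadow g a ha, s) (shadow g K hK) := by
  rw [shadow_eq_of_homotopic hL' (hτ.comp hK) hhom]
  exact shadow_pageDehnTwist_eq_transvection g hc τ hτ ha s φ β hφs hφ1 hφa hφp hφi hφo hβs hβ0
    hβ1 hτon hτoff hK hKc

end HurwitzMoveClasses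

open HurwitzMoveClasses

/-! ## §4 The registered form -/

/-- **Sub-goal `helper_shadow_seamTransport_free`** (piece (e) of the N1 contract, fully
qualified): free seam transport preserves the shadow — see `shadow_seamTransport_free`.
[cite: GompfStipsicz1999, §8.2] -/
theorem helper_shadow_seamTransport_free : ∀ (g n : ℕ) (X₀ : Type) [TopologicalSpace X₀] [ChartedSpace (EuclideanHalfSpace 4) X₀] (bX : Literature.Topology.FourManifolds.BoundaryData (𝓡∂ 4) X₀ (𝓡 3)) (Ψ : bX.carrier ≃ₘ⟮𝓡 3, 𝓡 3⟯ (Literature.Topology.FourManifolds.LefschetzBase.bBase g).carrier) (X : Type) [TopologicalSpace X] [ChartedSpace (EuclideanHalfSpace 4) X] (G₀ : X₀ ≃ₘ⟮𝓡∂ 4, 𝓡∂ 4⟯ X) (h : Fin n → Literature.Topology.FourManifolds.HandleAttachingMap 3 2 (Literature.Topology.FourManifolds.LefschetzBase.Base g)) (D : Literature.Topology.FourManifolds.HandleAttachingMap.MultiAttachmentData h (𝓡∂ 4) X) (d : Fin n → ℂ), (∀ k, ‖d k‖ = 1) → (∀ (y : bX.carrier) (a : ↥(Literature.Topology.FourManifolds.HandleAttachingMap.coresComplement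 h)), G₀ (bX.incl y) = D.jA a → ∃ c : ℝ, 0 < c ∧ Literature.Topology.FourManifolds.LefschetzBase.w g ((Literature.Topology.FourManifolds.LefschetzBase.bBase g).incl (Ψ y)).1 = (c : ℂ) * Literature.Topology.FourManifolds.LefschetzBase.w g (a : Literature.Topology.FourManifolds.LefschetzBase.Base g).1) → (∀ (y : bX.carrier) (k : Fin n) (b : ↥(Literature.Topology.FourManifolds.beltPiece 3 2)), G₀ (bX.incl y) = D.jB k b → G₀ (bX.incl y) ∉ Set.range D.jA → ∃ c : ℝ, 0 < c ∧ Literature.Topology.FourManifolds.LefschetzBase.w g ((Literature.Topology.FourManifolds.LefschetzBase.bBase g).incl (Ψ y)).1 = (c : ℂ) * d k) → ∀ (R : Literature.Topology.FourManifolds.AmbientIsotopy (𝓡∂ 4) (Literature.Topology.FourManifolds.LefschetzBase.Base g)), (∀ (t : ℝ) (x : Literature.Topology.FourManifolds.LefschetzBase.Base g), Literature.Topology.FourManifolds.LefschetzBase.rho g (R.toFun t x).1 = Literature.Topology.FourManifolds.LefschetzBase.rho g x.1) → (∀ (t : ℝ) (x : Literature.Topology.FourManifolds.LefschetzBase.Base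 g), Literature.Topology.FourManifolds.LefschetzBase.w g (R.toFun t x).1 = Complex.exp ((t : ℂ) * Complex.I) * Literature.Topology.FourManifolds.LefschetzBase.w g x.1) → ∀ (c₀ : ℂ) (T : ℝ), ‖c₀‖ = 1 → (∀ (k : Fin n), ∀ t ∈ Set.Icc (0 : ℝ) 1, d k ≠ c₀ * Complex.exp (((t * T : ℝ) : ℂ) * Complex.I)) → ∀ (L L' : Metric.sphere (0 : EuclideanSpace ℝ (Fin 2)) 1 → Literature.Topology.FourManifolds.LefschetzBase.Base g) (hL : Continuous L) (hL' : Continuous L') (y y' : Metric.sphere (0 : EuclideanSpace ℝ (Fin 2)) 1 → bX.carrier) (a a' : Metric.sphere (0 : EuclideanSpace ℝ (Fin 2)) 1 → ↥(Literature.Topology.FourManifolds.HandleAttachingMap.coresComplement h)), (∀ θ, L θ ∈ Literature.Topology.FourManifolds.LefschetzBase.page g c₀) → (∀ θ, G₀ (bX.incl (y θ)) = D.jA (a θ)) → (∀ θ, ((a θ : ↥(Literature.Topology.FourManifolds.HandleAttachingMap.coresComplement h)) : Literature.Topology.FourManifolds.LefschetzBase.Base g) = L θ) → (∀ θ, (Literature.Topology.FourManifolds.LefschetzBase.bBase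 g).incl (Ψ (y' θ)) = R.toFun T ((Literature.Topology.FourManifolds.LefschetzBase.bBase g).incl (Ψ (y θ)))) → (∀ θ, G₀ (bX.incl (y' θ)) = D.jA (a' θ)) → (∀ θ, ((a' θ : ↥(Literature.Topology.FourManifolds.HandleAttachingMap.coresComplement h)) : Literature.Topology.FourManifolds.LefschetzBase.Base g) = L' θ) → Literature.Topology.FourManifolds.LefschetzBase.shadow g L' hL' = Literature.Topology.FourManifolds.LefschetzBase.shadow g L hL :=
  fun _ _ _ _ _ bX Ψ _ _ _ G₀ _ D _ hd hseam hbelt R hRρ hRw _ T hc₀ hfree _ _ hL hL' _ _ _ _ hLp hy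
      ha hrel hy' ha' =>
    shadow_seamTransport_free bX Ψ G₀ D hd hseam hbelt R hRρ hRw hc₀ T hfree hL hL' hLp hy ha hrel
      hy' ha'

end Summit.SmoothPoincare4.SmoothPoincare4.Theorems.AcyclicBisectionExists.ModpBraidOrbits

end
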